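import Literature.NumberTheory.PAdicHodge.AinfWeierstrassOmegaPeriodNonvanishing
import Literature.NumberTheory.PAdicHodge.AinfWeierstrassOmegaPeriodModFilTwo
import HarnessLib

/-!
# The Hodge–Tate map of the supersingular formal group is nonzero: `∫_τ ω ∉ Fil² B_dR⁺` when `‖p‖ < ‖τ₁‖`

Topic `Literature/NumberTheory/PAdicHodge`; namespace `Literature.NumberTheory.PAdicHodge.AinfTop`. THEOREMS ONLY (no definition,
no named fact, no instance, no `sorry`). Sequel of `AinfWeierstrassOmegaPeriodNonvanishing` (`[τ] = [p]_W T₁`,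
`[p] = p·R + X^{p²}·S` with `S(T₁)` a unit at supersingular reduction, `p ≥ 5`; the witness `‖p‖ < ‖u₁‖^p`) and of
`AinfWeierstrassOmegaPeriodModFilTwo` (`∫_τ ω ≡ ι[τ] (mod Fil²)`).

TATE'S THEOREM for the formal group of an elliptic curve with good SUPERSINGULAR reduction (`p ≥ 5`), in the tree's currency:
the Hodge–Tate component `HT(τ) = [τ] mod Fil²` of the period map `T_pŴ(𝒪_{ℂ_F}) → gr¹B_dR⁺ ≅ ℂ_F(1)` is NOT identically zero.
Elementary TILT proof (no duality, no dimension count):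

* §1 `[τ] ∉ ξ²𝔸_inf` as soon as `‖p‖ < ‖u₁‖` (`torsionLift_not_mem_span_xi_sq`): reduce `[τ] = p·R(T₁) + T₁^{p²}·S(T₁)` modulo `p`
  to `𝒪♭ = 𝔸_inf/p` (`WittVector.constantCoeff`): `[τ]‾ = T̄₁^{p²}·(unit)`; if `[τ] = ξ² y` then `[τ]‾ = (p♭)² ȳ`; untilt
  (`♯ = PreTilt.untilt`, multiplicative, `(p♭)♯ = p`, `θ(x) ≡ (x̄)♯ (mod p)` so `‖T̄₁♯‖ = ‖u₁‖`): `‖u₁‖^{p²} ≤ ‖p‖²`, while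
  `[p](u₁) = 0` gives `‖p‖·‖u₁‖ ≤ ‖u₁‖^{p²}` (`‖R(u)‖ = ‖u‖`), i.e. `‖u₁‖^{p²} > ‖p‖²` — contradiction.
* §2 **`omegaPeriodHom_not_mem_filOne_sq`**: `∫_τ ω ∉ (Fil¹)²` for such `τ` (`𝔸_inf ∩ ξ²B_dR⁺ = ξ²𝔸_inf`,
  `mem_span_xi_pow_of_ainfToBdR_eq`; `∫_τ ω ≡ ι[τ]`), and the WITNESS **`exists_omegaPeriodHom_not_mem_filOne_sq`** (from the tree's
  `exists_tatePt_norm_p_lt_norm_pow`).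

Use: discharges hypothesis (HT) of the K1 capstone `KummerFilZeroCoboundarySupersingular` (crux K★ `stmt-BirchSwinnertonDyer-22226`)
and of `det_not_mem_fil_two_of_periodHoms` (Legendre transversality). BSD / K★ are not proved by any of this.

## References
* [Tate1967] J. Tate, *p-divisible groups* (1967), §4 (the Hodge–Tate decomposition; `T_p(G) → t_{G'}(ℂ)(1)` nonzero).
* [Fontaine1982FormesDifferentielles] J.-M. Fontaine, Invent. Math. 65 (1982), §5.
* [FontaineAsterisque223III] J.-M. Fontaine, Astérisque 223 (1994), Exp. II §1.2–1.5.
-/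

noncomputable section

open PowerSeries

namespace Literature.NumberTheory.PAdicHodge

open Literature Literature.NumberTheory.GaloisRepresentations Literature.NumberTheory.EllipticCurves WeierstrassCurve
open Literature.NumberTheory.GaloisRepresentations.IsNonarchimedeanLocalField Literature.NumberTheory.GaloisRepresentations.LubinTate

namespace AinfTop

variable {F : Type} [Field F] [ValuativeRel F] [TopologicalSpace F] [IsNonarchimedeanLocalField F] [CharZero F]
  {p : ℕ} [Fact p.Prime] [Fact (¬ IsUnit (p : integerC F))] [IsAdicComplete (Ideal.span {(p : integerC F)}) (integerC F)]
  {hθ : Function.Surjective (WittVector.fontaineTheta (integerC F) p)} (W : WeierstrassCurve ℤ)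

/-! ## §1 Reduction modulo `p` and untilting -/

omit [CharZero F] in
/-- **`θ(x) ≡ (x mod p)♯ (mod p)`** in `𝒪_{ℂ_F}`: `x − [x̄] ∈ p𝕎` (its `0`-th Witt component vanishes) and `θ([x̄]) = x̄♯`.
[cite: FontaineAsterisque223III, Exp. II §1.2.2] -/
theorem fontaineTheta_sub_untilt_constantCoeff_mem (x : Ainf (p := p) F) :
    WittVector.fontaineTheta (integerC F) p x - PreTilt.untilt (WittVector.constantCoeff x) ∈ Ideal.span {(p : integerC F)} := by
  have h1 : x - WittVector.teichmuller p (WittVector.constantCoeff x) ∈ Ideal.span {(p : Ainf (p := p) F)} := by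
    rw [WittVector.mem_span_p_iff_coeff_zero_eq_zero, ← WittVector.constantCoeff_apply, map_sub, WittVector.constantCoeff_apply,
      WittVector.constantCoeff_apply, WittVector.teichmuller_coeff_zero, sub_self]
  obtain ⟨c, hc⟩ := Ideal.mem_span_singleton'.1 h1
  rw [← WittVector.fontaineTheta_teichmuller, ← map_sub, ← hc, map_mul, map_natCast]
  exact Ideal.mem_span_singleton'.2 ⟨_, rfl⟩

omit [CharZero F] [Fact (¬ IsUnit (p : integerC F))] [IsAdicComplete (Ideal.span {(p : integerC F)}) (integerC F)] [Fact p.Prime] in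
/-- A unit of `𝒪_{ℂ_F}` has norm `1`. [folklore] -/
private theorem norm_coe_eq_one_of_isUnit {u : integerC F} (hu : IsUnit u) : ‖(u : CompletedAlgClosure F)‖ = 1 := by
  obtain ⟨v, rfl⟩ := hu
  set a : CompletedAlgClosure F := ((v : integerC F) : CompletedAlgClosure F) with ha
  set b : CompletedAlgClosure F := (((v⁻¹ : (integerC F)ˣ) : integerC F) : CompletedAlgClosure F) with hb
  have h1 : ‖a‖ ≤ 1 := norm_coe_integerC_le _
  have h2 : ‖b‖ ≤ 1 := norm_coe_integerC_le _
  have h3 : ‖a‖ * ‖b‖ = 1 := by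
    rw [← norm_mul, ha, hb, ← Subring.coe_mul, Units.mul_inv, Subring.coe_one, norm_one]
  by_contra hne
  have hlt : ‖a‖ < 1 := lt_of_le_of_ne h1 hne
  have : ‖a‖ * ‖b‖ < 1 := mul_lt_one_of_nonneg_of_lt_one_left (norm_nonneg _) hlt h2
  exact absurd h3 (ne_of_lt this)

/-- **`[τ] ∉ ξ²𝔸_inf`** for a Tate-module point `τ` of the supersingular formal group (`p ≥ 5`) with `‖p‖ < ‖u₁‖`: the Hodge–Tate
class of `τ` is nonzero. [cite: Tate1967, §4] [cite: Fontaine1982FormesDifferentielles, §5] -/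
theorem torsionLift_not_mem_span_xi_sq (hp5 : 5 ≤ p) (hΔ : ¬ (p : ℤ) ∣ W.Δ)
    (hA : (W.map (Int.castRingHom (ZMod p))).hasseCoeff p = 0) (τ : TatePt F p W)
    (h₁ : ‖(p : CompletedAlgClosure F)‖ < ‖(((seq W τ 1 : (maxNilIdealC F).toIdeal) : CBall F) : CompletedAlgClosure F)‖) :
    (of F p).symm (torsionLift W hθ (seq W τ) (mulPC_seq W τ)) ∉ Ideal.span {(xi : Ainf (p := p) F) ^ 2} := by
  have hp : p.Prime := Fact.out
  have hp2 : p ≠ 2 := by omega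
  intro hsq
  obtain ⟨R, S, hRS, hR0, hR1, hS0⟩ := exists_formalMul_prime_eq_of_hasseCoeff_eq_zero W hp2 hA
  -- notation
  set u : (maxNilIdealC F).toIdeal := seq W τ 1 with hu
  set x : CompletedAlgClosure F := ((u : CBall F) : CompletedAlgClosure F) with hx
  set T : (nilTheta F p hθ).toIdeal := torsionLiftShiftPt W hθ (seq W τ) (mulPC_seq W τ) 1 with hT
  have hθT : theta F p (T : AinfTop F p) = u := by rw [hT, coe_torsionLiftShiftPt, theta_torsionLiftShift]
  have hτT : torsionLift W hθ (seq W τ) (mulPC_seq W τ) = (mulP W T : AinfTop F p) := by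
    rw [hT, mulP_torsionLiftShiftPt, torsionLiftShift_zero]
  have hpC : 0 < ‖(p : CompletedAlgClosure F)‖ := by
    refine norm_pos_iff.2 fun h0 => ?_
    rw [← map_natCast (algebraMap F (CompletedAlgClosure F)), _root_.map_eq_zero] at h0
    exact (Nat.cast_ne_zero.2 hp.ne_zero) h0
  have hxp : ‖(p : CompletedAlgClosure F)‖ < ‖x‖ := h₁
  have hx1 : ‖x‖ < 1 := u.2
  have hxpos : 0 < ‖x‖ := hpC.trans hxp
  -- (A) `[p](u) = 0` gives `‖p‖·‖u‖ ≤ ‖u‖^{p²}`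
  have hpu0 : ((mulPC F p W u : (maxNilIdealC F).toIdeal) : CBall F) = 0 := by rw [hu, mulPC_seq, seq_zero]
  obtain ⟨R', hR'⟩ := PowerSeries.X_dvd_iff.mpr hR0
  have hR'0 : constantCoeff R' = 1 := by
    have h := congrArg (coeff 1) hR'
    rw [hR1, PowerSeries.coeff_succ_X_mul, coeff_zero_eq_constantCoeff] at h
    exact h.symm
  obtain ⟨R₁, hR₁⟩ := PowerSeries.X_dvd_iff.mpr (show constantCoeff (R' - 1) = 0 by rw [map_sub, hR'0, map_one, sub_self])
  have hRu : (evalAt (maxNilIdealC F) u R : CompletedAlgClosure F) =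
      x * (1 + (evalAt (maxNilIdealC F) u (X * R₁) : CompletedAlgClosure F)) := by
    have hR'' : R = X * (1 + X * R₁) := by rw [← hR₁, add_sub_cancel, hR']
    rw [hR'', map_mul, map_add, map_one, evalAt_maxNilIdealC_X, Subring.coe_mul, Subring.coe_add, Subring.coe_one]
  have hsmall : ‖((evalAt (maxNilIdealC F) u (X * R₁) : CBall F) : CompletedAlgClosure F)‖ < 1 :=
    lt_of_le_of_lt (NumberTheory.EllipticCurves.norm_evalAt_le_of_constantCoeff u
      (by rw [map_mul, constantCoeff_X, zero_mul])) hx1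
  have hone : ‖(1 : CompletedAlgClosure F) + (evalAt (maxNilIdealC F) u (X * R₁) : CompletedAlgClosure F)‖ = 1 := by
    rw [IsUltrametricDist.norm_add_eq_max_of_norm_ne_norm (by rw [norm_one]; exact (ne_of_lt hsmall).symm), norm_one,
      max_eq_left hsmall.le]
  have hnormR : ‖(evalAt (maxNilIdealC F) u R : CompletedAlgClosure F)‖ = ‖x‖ := by
    rw [hRu, norm_mul, hone, mul_one]
  have heval := coe_mulPC_eq_of_decomp W hRS u
  rw [hpu0] at heval
  have hS1 : ‖((evalAt (maxNilIdealC F) u S : CBall F) : CompletedAlgClosure F)‖ ≤ 1 :=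
    NumberTheory.EllipticCurves.norm_coe_unitBall_le_one _
  have hkey : ‖(p : CompletedAlgClosure F)‖ * ‖x‖ ≤ ‖x‖ ^ (p ^ 2) := by
    have h1 : ((p : CBall F) : CompletedAlgClosure F) * (evalAt (maxNilIdealC F) u R : CompletedAlgClosure F) =
        -(x ^ (p ^ 2) * (evalAt (maxNilIdealC F) u S : CompletedAlgClosure F)) := by
      have h := congrArg (fun z : CBall F => (z : CompletedAlgClosure F)) heval
      simp only [Subring.coe_add, Subring.coe_mul, SubmonoidClass.coe_pow, Subring.coe_zero] at h
      exact eq_neg_of_add_eq_zero_left h.symm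
    have h2 := congrArg (fun z => ‖z‖) h1
    simp only [norm_mul, norm_neg, norm_pow, hnormR, Subring.coe_natCast] at h2
    rw [h2]
    exact mul_le_of_le_one_right (pow_nonneg (norm_nonneg _) _) hS1
  have hlow : ‖(p : CompletedAlgClosure F)‖ ^ 2 < ‖x‖ ^ (p ^ 2) :=
    calc ‖(p : CompletedAlgClosure F)‖ ^ 2 = ‖(p : CompletedAlgClosure F)‖ * ‖(p : CompletedAlgClosure F)‖ := pow_two _
      _ < ‖(p : CompletedAlgClosure F)‖ * ‖x‖ := mul_lt_mul_of_pos_left hxp hpC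
      _ ≤ ‖x‖ ^ (p ^ 2) := hkey
  -- (B) `[τ] = p·R(T) + T^{p²}·(unit)` in `𝔸_inf`
  set c : ℤ := coeff (p ^ 2) (W.formalMul p) with hc
  obtain ⟨m, hm⟩ := prime_dvd_coeff_sq_formalMul_add_one W hp5 hΔ hA
  obtain ⟨S₁, hS₁⟩ := PowerSeries.X_dvd_iff.mpr (show PowerSeries.constantCoeff (S - C c) = 0 by
    rw [map_sub, hS0, PowerSeries.constantCoeff_C, sub_self])
  have hS : S = C c + X * S₁ := by rw [← hS₁, add_sub_cancel]
  haveI : IsAdicComplete (WithIdeal.i : Ideal (AinfTop F p)) (AinfTop F p) := isAdicComplete_span_p_xi (F := F) (p := p)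
  have hpJ : (p : AinfTop F p) ∈ (⊥ : Ideal (AinfTop F p)).jacobson :=
    IsAdicComplete.le_jacobson_bot (WithIdeal.i : Ideal (AinfTop F p))
      (by rw [ideal_eq]; exact Ideal.subset_span (Set.mem_insert _ _))
  have hcu : IsUnit ((c : ℤ) : AinfTop F p) := by
    have h1 : IsUnit ((p : AinfTop F p) * (-(m : AinfTop F p)) + 1) := Ideal.mem_jacobson_bot.1 hpJ _
    have h2 : ((c : ℤ) : AinfTop F p) = -((p : AinfTop F p) * (-(m : AinfTop F p)) + 1) := by
      have h3 : (c : ℤ) = p * m - 1 := by linarith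
      rw [h3]; push_cast; ring
    rw [h2]; exact h1.neg
  have haJ : (T : AinfTop F p) ∈ (⊥ : Ideal (AinfTop F p)).jacobson := mem_jacobson_bot_of_mem_nilTheta T.2
  have hevalT : (mulP W T : AinfTop F p) = (p : AinfTop F p) * evalAt (nilTheta F p hθ) T R +
      (T : AinfTop F p) ^ (p ^ 2) * ((c : AinfTop F p) + (T : AinfTop F p) * evalAt (nilTheta F p hθ) T S₁) := by
    rw [mulP, coe_evalPt₁_eq_evalAt, hRS, hS, map_add, map_mul, map_mul, map_add, map_mul, map_pow, evalAt_nilTheta_X,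
      evalAt_nilTheta_C, evalAt_nilTheta_C, Int.cast_natCast]
  have hunit : IsUnit ((c : AinfTop F p) + (T : AinfTop F p) * evalAt (nilTheta F p hθ) T S₁) := by
    obtain ⟨cu, hcu'⟩ := hcu
    have h1 : IsUnit ((T : AinfTop F p) * (evalAt (nilTheta F p hθ) T S₁ * ↑cu⁻¹) + 1) := Ideal.mem_jacobson_bot.1 haJ _
    have h2 : (c : AinfTop F p) + (T : AinfTop F p) * evalAt (nilTheta F p hθ) T S₁ =
        (cu : AinfTop F p) * ((T : AinfTop F p) * (evalAt (nilTheta F p hθ) T S₁ * ↑cu⁻¹) + 1) := by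
      rw [show (cu : AinfTop F p) * ((T : AinfTop F p) * (evalAt (nilTheta F p hθ) T S₁ * ↑cu⁻¹) + 1) =
        (T : AinfTop F p) * evalAt (nilTheta F p hθ) T S₁ * ((cu : AinfTop F p) * ↑cu⁻¹) + cu by ring,
        Units.mul_inv, mul_one, hcu', add_comm]
    rw [h2]; exact (Units.isUnit cu).mul h1
  obtain ⟨s, hs⟩ := hunit
  -- (C) reduce modulo `p`: `[τ]‾ = T̄^{p²}·s̄` and `[τ]‾ = (p♭)² ȳ`
  set Tb : PreTilt (integerC F) p := WittVector.constantCoeff ((of F p).symm (T : AinfTop F p)) with hTb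
  set sb : PreTilt (integerC F) p := WittVector.constantCoeff ((of F p).symm (s : AinfTop F p)) with hsb
  have hsbu : IsUnit sb := (Units.isUnit s).map ((WittVector.constantCoeff).comp (of F p).symm.toRingHom)
  have hred : WittVector.constantCoeff ((of F p).symm (torsionLift W hθ (seq W τ) (mulPC_seq W τ))) = Tb ^ (p ^ 2) * sb := by
    rw [hτT, hevalT, ← hs]
    simp only [map_add, map_mul, map_pow, map_natCast, CharP.cast_eq_zero, zero_mul, zero_add, hTb, hsb]
  obtain ⟨y, hy⟩ := Ideal.mem_span_singleton'.1 hsq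
  have hred' : Tb ^ (p ^ 2) * sb = pFlat ^ 2 * WittVector.constantCoeff y := by
    rw [← hred, ← hy, map_mul, map_pow, constantCoeff_xi, mul_comm]
  -- (D) untilt and take norms in `ℂ_F`
  have hunt := congrArg (fun z : PreTilt (integerC F) p => ((PreTilt.untilt z : integerC F) : CompletedAlgClosure F)) hred'
  simp only [map_mul, map_pow, untilt_pFlat, Subring.coe_mul, SubmonoidClass.coe_pow, Subring.coe_natCast] at hunt
  have hnorm := congrArg (fun z => ‖z‖) hunt
  simp only [norm_mul, norm_pow] at hnorm
  have hsb1 : ‖((PreTilt.untilt sb : integerC F) : CompletedAlgClosure F)‖ = 1 :=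
    norm_coe_eq_one_of_isUnit (hsbu.map PreTilt.untilt)
  have hy1 : ‖((PreTilt.untilt (WittVector.constantCoeff y) : integerC F) : CompletedAlgClosure F)‖ ≤ 1 := norm_coe_integerC_le _
  rw [hsb1, mul_one] at hnorm
  -- `‖T̄♯‖ = ‖u₁‖`
  have hTu : ‖((PreTilt.untilt Tb : integerC F) : CompletedAlgClosure F)‖ = ‖x‖ := by
    have hdiff := fontaineTheta_sub_untilt_constantCoeff_mem ((of F p).symm (T : AinfTop F p))
    obtain ⟨d, hd⟩ := Ideal.mem_span_singleton'.1 hdiff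
    have hθx : ((WittVector.fontaineTheta (integerC F) p ((of F p).symm (T : AinfTop F p)) : integerC F) : CompletedAlgClosure F) = x := by
      rw [hx, ← hθT, ← coe_theta]; rfl
    set b : CompletedAlgClosure F := ((PreTilt.untilt Tb : integerC F) : CompletedAlgClosure F) with hbdef
    have hd' := congrArg (fun z : integerC F => (z : CompletedAlgClosure F)) hd
    simp only [Subring.coe_mul, Subring.coe_natCast, AddSubgroupClass.coe_sub] at hd'
    have hle : ‖x - b‖ ≤ ‖(p : CompletedAlgClosure F)‖ := by
      rw [← hθx, hbdef, hTb, ← hd', norm_mul]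
      exact mul_le_of_le_one_left (norm_nonneg _) (norm_coe_integerC_le d)
    have hlt : ‖x - b‖ < ‖x‖ := hle.trans_lt hxp
    have hne : ‖x‖ ≠ ‖-(x - b)‖ := by rw [norm_neg]; exact (ne_of_lt hlt).symm
    have h := IsUltrametricDist.norm_add_eq_max_of_norm_ne_norm hne
    rw [show x + -(x - b) = b by ring, norm_neg, max_eq_left hlt.le] at h
    exact h
  rw [hTu] at hnorm
  -- contradiction: `‖x‖^{p²} = ‖p‖² ‖ȳ♯‖ ≤ ‖p‖² < ‖x‖^{p²}`
  have hle : ‖x‖ ^ (p ^ 2) ≤ ‖(p : CompletedAlgClosure F)‖ ^ 2 := by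
    rw [hnorm]; exact mul_le_of_le_one_right (pow_nonneg (norm_nonneg _) _) hy1
  exact absurd (hlow.trans_le hle) (lt_irrefl _)

/-! ## §2 The ω-period is transverse to `Fil²` -/

/-- **`∫_τ ω ∉ Fil² B_dR⁺` when `‖p‖ < ‖u₁‖`** (good supersingular reduction, `p ≥ 5`): the Hodge–Tate component of `τ` is nonzero.
[cite: Tate1967, §4] [cite: Fontaine1982FormesDifferentielles, §5] -/
theorem omegaPeriodHom_not_mem_filOne_sq (hp5 : 5 ≤ p) (hΔ : ¬ (p : ℤ) ∣ W.Δ)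
    (hA : (W.map (Int.castRingHom (ZMod p))).hasseCoeff p = 0) (τ : TatePt F p W)
    (h₁ : ‖(p : CompletedAlgClosure F)‖ < ‖(((seq W τ 1 : (maxNilIdealC F).toIdeal) : CBall F) : CompletedAlgClosure F)‖) :
    omegaPeriodHom W hθ τ ∉ ((BdRPlusTop.filOne F p).toIdeal ^ 2 : Ideal (BdRPlusTop F p)) := by
  intro hmem
  have hsq : (torsionLiftFil W hθ (seq W τ) (seq_zero W τ) (mulPC_seq W τ) : BdRPlusTop F p) ∈
      ((BdRPlusTop.filOne F p).toIdeal ^ 2 : Ideal (BdRPlusTop F p)) := by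
    have h := omegaPeriod_sub_torsionLiftFil_mem_sq W (hθ := hθ) (seq_zero W τ) (mulPC_seq W τ)
    have h2 : (torsionLiftFil W hθ (seq W τ) (seq_zero W τ) (mulPC_seq W τ) : BdRPlusTop F p) =
        omegaPeriodHom W hθ τ - (omegaPeriod W hθ (seq W τ) (seq_zero W τ) (mulPC_seq W τ) -
          (torsionLiftFil W hθ (seq W τ) (seq_zero W τ) (mulPC_seq W τ) : BdRPlusTop F p)) := by
      rw [omegaPeriodHom_apply]; ring
    rw [h2]
    exact sub_mem hmem h
  -- `ι[τ] ∈ (ξ_dR)²` ⟹ `[τ] ∈ ξ²𝔸_inf`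
  rw [coe_torsionLiftFil, show (BdRPlusTop.filOne F p).toIdeal = (WithIdeal.i : Ideal (BdRPlusTop F p)) from rfl,
    BdRPlusTop.ideal_eq, Ideal.span_singleton_pow, Ideal.mem_span_singleton'] at hsq
  obtain ⟨w, hw⟩ := hsq
  apply torsionLift_not_mem_span_xi_sq W hp5 hΔ hA τ h₁ (hθ := hθ)
  refine GaloisContinuity.mem_span_xi_pow_of_ainfToBdR_eq (w := (BdRPlusTop.of F p).symm w) ?_
  have h := congrArg (BdRPlusTop.of F p).symm hw
  rw [map_mul, map_pow, RingEquiv.symm_apply_apply] at h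
  rw [mul_comm]
  exact h.symm

/-- **Tate's Hodge–Tate nonvanishing, as a witness**: at a prime `p ≥ 5` of good supersingular reduction of `W/ℤ`, for every `p`-adic
field `F` some `τ ∈ T_pŴ(𝒪_{ℂ_F})` has `∫_τ ω ∉ Fil² B_dR⁺(F)` (witness: any `τ` with `‖p‖ < ‖u₁‖^p`).
[cite: Tate1967, §4] [cite: Fontaine1982FormesDifferentielles, §5] -/
theorem exists_omegaPeriodHom_not_mem_filOne_sq (hp5 : 5 ≤ p) (hΔ : ¬ (p : ℤ) ∣ W.Δ)
    (hA : (W.map (Int.castRingHom (ZMod p))).hasseCoeff p = 0) :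
    ∃ τ : TatePt F p W, omegaPeriodHom W hθ τ ∉ ((BdRPlusTop.filOne F p).toIdeal ^ 2 : Ideal (BdRPlusTop F p)) := by
  have hp2 : p ≠ 2 := by omega
  obtain ⟨τ, hτ1, hτ⟩ := exists_tatePt_norm_p_lt_norm_pow F p W hp2 hΔ hA
  refine ⟨τ, omegaPeriodHom_not_mem_filOne_sq W hp5 hΔ hA τ (hτ.trans_le ?_)⟩
  calc ‖(((seq W τ 1 : (maxNilIdealC F).toIdeal) : CBall F) : CompletedAlgClosure F)‖ ^ p
      ≤ ‖(((seq W τ 1 : (maxNilIdealC F).toIdeal) : CBall F) : CompletedAlgClosure F)‖ ^ 1 :=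
        pow_le_pow_of_le_one (norm_nonneg _) hτ1.le (Fact.out : p.Prime).pos
    _ = _ := pow_one _

end AinfTop

end Literature.NumberTheory.PAdicHodge

end
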